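import Summits.AtomisticToContinuum.Crystallization.Theses.ThreeConeCertificate
import Summits.AtomisticToContinuum.Crystallization.Theses.PhononSlackCertificates
import Summits.AtomisticToContinuum.Crystallization.Theses.PalmUnimodularRigidity
import Summits.AtomisticToContinuum.Crystallization.Theorems.ThreeConeCertificateSlackRigidityOfPalmRigidity
import Summits.AtomisticToContinuum.Crystallization.Theorems.PalmUnimodularRigidityCruxesToPalmRigidity
import Summits.AtomisticToContinuum.Crystallization.Theorems.MinimiserShells.Negative.LoadBearing
import Summits.AtomisticToContinuum.Crystallization.Theorems.ThreeConeCertificateSlackRigidityPricedFloorsDefs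
import Summits.AtomisticToContinuum.Crystallization.Theorems.ThreeConeCertificateSlackRigidityPricedFloorsSelection
import Summits.AtomisticToContinuum.Crystallization.Theorems.ThreeConeCertificateSlackRigidityPricedFloorsApplication
import Summits.AtomisticToContinuum.Crystallization.Theorems.ThreeConeCertificateSlackRigidityPricedFloorsSandwich
import Summits.AtomisticToContinuum.Crystallization.Theorems.ThreeConeCertificateSlackRigidityPricedFloorsExactify
import Summits.AtomisticToContinuum.Crystallization.Theorems.ThreeConeCertificateSlackRigidityPricedFloorsGlobalize
import Summits.AtomisticToContinuum.Crystallization.Theorems.ThreeConeCertificateSlackRigidityPricedFloorsFinal4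
import Summits.AtomisticToContinuum.Crystallization.Theorems.ThreeConeCertificateSlackRigidityPricedFloorsLayerFloor
import Summits.AtomisticToContinuum.Crystallization.Theorems.ThreeConeCertificateSlackRigidityHcpAdmissible
import Summits.AtomisticToContinuum.Crystallization.Theorems.ThreeConeCertificateSlackRigidityFlrOfPalm
import Literature.Probability.Process.LocallyMatches
import Literature.Probability.Process.PointStationaryLaw
import Literature.MathematicalPhysics.StatisticalMechanics.RootEnergy
import Literature.MathematicalPhysics.StatisticalMechanics.BarlowStacking
import HarnessLib

/-!
# Crux `SlackRigidity` (stmt-AtomisticToContinuum-11960) — line `priced-floors-palm-exactification`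
# Skeleton, RESHAPED by lead c19 (2026-08-17): seven registered stubs, composition kernel-checked;
# lead c21 (2026-08-17T11Z): residual WEAKENED — closed modulo `FiniteLayerRigidity` ⇐ `LayerFloor` ⇐ 13956 ∧ 13958 (all arrows landed, p156040)
# lead c22 (2026-08-17T12Z): residual PINNED — `PalmRigidity ↔ FiniteLayerRigidity ∧ HcpOptimalInBox` (p159046); optimal relaxed hcp certified ADMISSIBLE (p158430)

Route `ThreeConeCertificate`, sub-problem `Crystallization`.  Line registered by the crux strategist
(`Lines/priced-floors-palm-exactification.md`); this file is the lead's reshape of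
`Lines/priced_floors_palm_exactification.lean` into worker-sized stubs.

THE LINE.  `SlackRigidity` is `PalmRigidity` away (landed closure
`EkelandSurgeryParityClosure.slackRigidity_of_palmRigidity`, p122051), and `PalmRigidity` (item 9224) is
proved here from SEVEN stubs none of which contains the crux:

* `stub_pricedInequalities` = items 13956 `CoerciveTwoShellGap` ∧ 13958 `NearFieldConvexity` of the OPEN
  route `PhononSlackCertificates`, BY NAME (the one-scale wall; not worked in this line);
* `stub_clusterSelection` (S1 engine): generic form of the LANDED `SlackRigidityLawSelection.exists_badCluster`
  (p131361) — any measurable event of positive failure probability under a minimising point-stationary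
  hard-core law is failed by a positive fraction of DEEP points of arbitrarily large near-minimal finite
  clusters inside a separated sample;
* `stub_layeredSandwich` (S1 measurability): a Giry-measurable event squeezed between the `η/2`-layered-root
  event (radii `2,2`) and the `η`-layered-root event with pattern-side radius `19/10` (countable union of
  proxy events over countable dense layering data; the radius loss absorbs the approximation);
* `stub_floorsApplication` (S1 energetics): 13956 bounds the `1/20`-bad particles of a near-minimal cluster
  by `(τ/g)#T`, 13958 on the good particles charges every deep non-layered one — so every measurable event
  containing the `η`-layered-root event has full probability;
* `stub_exactify` (S2a, compactness): `η`-layered for every `η` ⇒ exactly layered at the point;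
* `stub_globalize` (S2b, exact local-to-global layer lemma, pure geometry): every point exactly layered ⇒
  the rooted set is ONE admissible layered set after a translation (Hales's layer induction with the
  pattern identification given and non-ideal spacings allowed);
* `stub_layeredMeanSelection` (S3, Hägg selection in mean on exactly layered support; the lead's stub).

Glue proved here (sorry-free): `floorsToLaw_of` (S1 = engine + sandwich + application + the LANDED
root-to-everywhere transfer `PalmUnimodularRigidity.ae_forall_map_sub_of_ae`), `exactLayeredGlobal_of`
(S2 = S2a + S2b), `PalmRigidity_of_stubs`, `SlackRigidity_of_stubs`, `SlackRigidity_of : SlackRigidity`.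

LEAD c21 (what changed).  The pair 13956 ∧ 13958 enters the chain ONLY through `stub_floorsApplication`,
and that proof consumes strictly less than the pair.  LANDED (p156040,
`Theorems/ThreeConeCertificateSlackRigidityPricedFloorsLayerFloor.lean`, six registered sub-goals `lms_*`):
`CoerciveTwoShellGap → NearFieldConvexity → LayerFloor → FiniteLayerRigidity → (floors application) →
PalmRigidity → SlackRigidity`, where `LayerFloor` (strategist's S⁺₆: `N e* + κ(δ,η) #{i not η-layered at
radius 2} ≤ 𝓔(x)` on δ-separated `x`) and `FiniteLayerRigidity` (qualitative: for all `δ, η, b > 0` there are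
`τ > 0`, `M` with `#{i not η-layered} ≤ b N` for every δ-separated `x` of `N ≥ M` points with
`𝓔(x) ≤ N e* + τ N`) are selector-free ONE-SCALE statements WEAKER than the pair.  The registered `sorry`
below stays `stub_pricedInequalities` (the FILED items, staffed by their own chains — no seat should be
spent on the unfiled weaker forms), and the two weaker closing paths are read back sorry-free (as
`example`s) in § Alternative residuals: the crux is closed modulo ANY ONE of {13956 ∧ 13958, LayerFloor,
FiniteLayerRigidity}.

LEAD c22 (what changed).  Two files landed `--supports` the crux.  (1) CERTIFIED ADMISSIBILITY of the
optimal relaxed hcp (`…Theorems.SlackRigidityHcpAdmissible`, p158430): every box-minimiser `(a, h)` of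
`e(hcp(a, h))` on `[1/2, 2]²` — in particular the `PalmRigidity` template `e(hcp a h) = ⨅_Q e(Q)` — has
`h/a ∈ (0.8148, 0.8250)` and `a ∈ [0.963, 0.976]`, hence is admissible layering data of item 13958
(`a ∈ [47/50, 1]`, `h ∈ [39a/50, 17a/20]`); this removes the cheap falsity mode of `NearFieldConvexity` AS
TYPED flagged by c21 (interior of an optimal-hcp block good-but-never-η-layered).  (2) THE CONVERSE
(`…Theorems.SlackRigidityFlrOfPalm`, p159046): `PalmRigidity → FiniteLayerRigidity`, whence
`PalmRigidity ↔ FiniteLayerRigidity ∧ HcpOptimalInBox` and `HcpOptimalInBox → (FiniteLayerRigidity ↔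
SlackRigidity)` — the weakest residual of the line IS the crux at one scale (modulo "an optimal relaxed hcp
lies in the box", the second conjunct of item 9224).  Read back sorry-free in § Faithfulness below.  The ONE
registered `sorry` is unchanged: `stub_pricedInequalities` = items 13956 ∧ 13958 (open, staffed).

VOCABULARY.  The predicates `layeredSet`, `IsAdmissibleLayering`, `LayeredAt`, `ExactLayeredAt`,
`IsMinimisingLaw`, `ClusterSelectionFor`, `GlobalLayered`, `IsOptimalHcpSample` are the LANDED Theorems
module `ThreeConeCertificateSlackRigidityPricedFloorsDefs` (p137972, namespace
`…Theorems.SlackRigidityPricedFloors`), imported here.  Stub files import the same module and state the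
stub signatures below verbatim.

Why this dodges the recorded deaths (`Lines/*-dead.md`, lead c18): no stub contains the crux (13956/13958
are finite-`N` one-scale priced inequalities, FILED and staffed; S1 is an implication from them; S2 is
potential-free geometry; S3 is conditional on exactly layered support); see the line card and
`STRATEGY-CENSUS.md`.
-/

noncomputable section

open MeasureTheory Filter Set
open scoped ENNReal BigOperators Topology

/-! ## The line -/

namespace Summit.AtomisticToContinuum.Crystallization.Cruxes.SlackRigidity.PricedFloorsPalmExactification

open Literature.Probability.Process
open Literature.MathematicalPhysics.StatisticalMechanics
open Summit.AtomisticToContinuum.Crystallization.Theses.ThreeConeCertificate (SlackRigidity)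
open Summit.AtomisticToContinuum.Crystallization.Theses.PalmUnimodularRigidity (PalmRigidity)
open Summit.AtomisticToContinuum.Crystallization.Theses.PhononSlackCertificates
  (CoerciveTwoShellGap NearFieldConvexity)
open Summit.AtomisticToContinuum.Crystallization.Theorems
open Summit.AtomisticToContinuum.Crystallization.Theorems.MinimiserShells.Negative.LoadBearing (eStar)
open Summit.AtomisticToContinuum.Crystallization.Theorems.SlackRigidityPricedFloors

/-! ## Registered stubs (the ONLY `sorry`s of this file) -/

/-- **Registered stub 0** = items stmt-AtomisticToContinuum-13956 `CoerciveTwoShellGap` (target of route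
`PhononSlackCertificates`) and stmt-AtomisticToContinuum-13958 `NearFieldConvexity` (crux of the same
route), BY NAME.  OPEN (the one-scale wall; Flyspeck-scale certified priced local inequalities + certified
phonon coercivity).  Not worked in this line. -/
theorem stub_pricedInequalities : CoerciveTwoShellGap ∧ NearFieldConvexity := by
  sorry

/-- **Registered stub 1** (`clusterSelection`, S1 engine, size L): generic form of
`SlackRigidityLawSelection.exists_badCluster` (p131361) — the same cell-averaging proof with the bad
functional `1[θ_y μ ∉ G] · 1[phase deep]` for an ABSTRACT measurable `G`, deepness and the separated
sample made explicit in the conclusion. -/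
theorem stub_clusterSelection : ∀ δ : ℝ, 0 < δ → ∀ P : Measure (Measure E3), IsProbabilityMeasure P → IsMinimisingLaw δ P → ∀ G : Set (Measure E3), MeasurableSet G → P Gᶜ ≠ 0 → ClusterSelectionFor δ G :=
  -- LANDED p138907 (worker W1)
  SlackRigidityPricedFloorsSelection.stub_clusterSelection

/-- **Registered stub 2** (`layeredSandwich`, S1 measurability, size M).  LANDED p139386 (worker W2) as
`SlackRigidityPricedFloorsSandwich.stub_layeredSandwich` (p139386) — PLUGGED IN. -/
theorem stub_layeredSandwich : ∀ δ η : ℝ, 0 < δ → 0 < η → ∃ G : Set (Measure E3), MeasurableSet G ∧ (∀ μ : Measure E3, IsRootedHardCore δ μ → μ ∈ G → LayeredAt 2 (19 / 10) η (atoms μ) 0) ∧ (∀ μ : Measure E3, IsRootedHardCore δ μ → LayeredAt 2 2 (η / 2) (atoms μ) 0 → μ ∈ G) :=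
  SlackRigidityPricedFloorsSandwich.stub_layeredSandwich

/-- **Registered stub 3** (`floorsApplication`, S1 energetics, size M–L). -/
theorem stub_floorsApplication : CoerciveTwoShellGap → NearFieldConvexity → ∀ δ : ℝ, 0 < δ → ∀ P : Measure (Measure E3), IsProbabilityMeasure P → IsMinimisingLaw δ P → (∀ G : Set (Measure E3), MeasurableSet G → P Gᶜ ≠ 0 → ClusterSelectionFor δ G) → ∀ η : ℝ, 0 < η → ∀ G : Set (Measure E3), MeasurableSet G → (∀ μ : Measure E3, IsRootedHardCore δ μ → LayeredAt 2 2 η (atoms μ) 0 → μ ∈ G) → P Gᶜ = 0 :=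
  -- LANDED p139033 (worker W3)
  SlackRigidityPricedFloorsApplication.stub_floorsApplication

/-- **Registered stub 4** (`exactify`, S2a, size M).  LANDED p139549 (worker W4) as
`SlackRigidityPricedFloorsExactify.stub_exactify` (p139549) — PLUGGED IN. -/
theorem stub_exactify : ∀ δ : ℝ, 0 < δ → ∀ S : Set E3, (∀ x ∈ S, ∀ y ∈ S, x ≠ y → δ ≤ dist x y) → ∀ y ∈ S, (∀ η : ℝ, 0 < η → LayeredAt 2 (19 / 10) η S y) → ExactLayeredAt S y :=
  SlackRigidityPricedFloorsExactify.stub_exactify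

/-- **Registered stub 5** (`globalize`, S2b, size L–XL). -/
theorem stub_globalize : ∀ δ : ℝ, 0 < δ → ∀ S : Set E3, (0 : E3) ∈ S → (∀ x ∈ S, ∀ y ∈ S, x ≠ y → δ ≤ dist x y) → (∀ y ∈ S, ExactLayeredAt S y) → GlobalLayered S :=
  SlackRigidityPricedFloorsGlobalize.stub_globalize

/-- **Registered stub 6** (`layeredMeanSelection`, S3, size L–XL; the lead's stub). -/
theorem stub_layeredMeanSelection : ∀ δ : ℝ, 0 < δ → ∀ P : Measure (Measure E3), IsProbabilityMeasure P → IsMinimisingLaw δ P → (∀ᵐ μ ∂P, GlobalLayered (atoms μ)) → ∀ᵐ μ ∂P, IsOptimalHcpSample μ :=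
  -- LANDED (Final4, lead c19; parts Final0–Final3 + 40 supporting files)
  SlackRigidityPricedFloorsFinal.stub_layeredMeanSelection

/-! ## Glue (sorry-free in the stub STATEMENTS) -/

/-- **S1 composed**: engine + sandwich + application + root-to-everywhere give, for a minimising
point-stationary hard-core law, almost surely EVERY point `η`-layered (radii `2, 19/10`) for every
`η > 0`. -/
theorem floorsToLaw_of
    (hsel : ∀ δ : ℝ, 0 < δ → ∀ P : Measure (Measure E3), IsProbabilityMeasure P → IsMinimisingLaw δ P →
      ∀ G : Set (Measure E3), MeasurableSet G → P Gᶜ ≠ 0 → ClusterSelectionFor δ G)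
    (hsand : ∀ δ η : ℝ, 0 < δ → 0 < η → ∃ G : Set (Measure E3), MeasurableSet G ∧
      (∀ μ : Measure E3, IsRootedHardCore δ μ → μ ∈ G → LayeredAt 2 (19 / 10) η (atoms μ) 0) ∧
      (∀ μ : Measure E3, IsRootedHardCore δ μ → LayeredAt 2 2 (η / 2) (atoms μ) 0 → μ ∈ G))
    (happ : CoerciveTwoShellGap → NearFieldConvexity → ∀ δ : ℝ, 0 < δ → ∀ P : Measure (Measure E3),
      IsProbabilityMeasure P → IsMinimisingLaw δ P →
      (∀ G : Set (Measure E3), MeasurableSet G → P Gᶜ ≠ 0 → ClusterSelectionFor δ G) →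
      ∀ η : ℝ, 0 < η → ∀ G : Set (Measure E3), MeasurableSet G →
      (∀ μ : Measure E3, IsRootedHardCore δ μ → LayeredAt 2 2 η (atoms μ) 0 → μ ∈ G) → P Gᶜ = 0)
    (h56 : CoerciveTwoShellGap) (h58 : NearFieldConvexity)
    {δ : ℝ} (hδ : 0 < δ) (P : Measure (Measure E3)) [hP : IsProbabilityMeasure P]
    (hlaw : IsMinimisingLaw δ P) :
    ∀ᵐ μ ∂P, ∀ y ∈ atoms μ, ∀ η : ℝ, 0 < η → LayeredAt 2 (19 / 10) η (atoms μ) y := by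
  -- Step 1: for each `n`, a.s. the ROOT is `1/(n+1)`-layered with radii `(2, 19/10)`
  have hroot : ∀ n : ℕ, ∀ᵐ μ ∂P, LayeredAt 2 (19 / 10) (1 / ((n : ℝ) + 1)) (atoms μ) 0 := by
    intro n
    have hη : (0 : ℝ) < 1 / ((n : ℝ) + 1) := by positivity
    obtain ⟨G, hGm, hGup, hGlow⟩ := hsand δ (1 / ((n : ℝ) + 1)) hδ hη
    have hPG : P Gᶜ = 0 :=
      happ h56 h58 δ hδ P hP hlaw (hsel δ hδ P hP hlaw) (1 / ((n : ℝ) + 1) / 2) (by positivity) G hGm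
        (fun μ hc hl => hGlow μ hc hl)
    have hae : ∀ᵐ μ ∂P, μ ∈ G := by
      rw [ae_iff]
      simpa only [Set.compl_def] using hPG
    filter_upwards [hae, hlaw.1] with μ hμ hc
    exact hGup μ hc hμ
  -- Step 2: root ⇒ every point (mass transport), then all `η` by monotonicity
  have hall : ∀ᵐ μ ∂P, ∀ n : ℕ, LayeredAt 2 (19 / 10) (1 / ((n : ℝ) + 1)) (atoms μ) 0 :=
    ae_all_iff.2 hroot
  have hlf : ∀ᵐ μ ∂P, ∀ n : ℕ, μ ((fun z : E3 => ⌊‖z‖⌋₊) ⁻¹' {n}) < ⊤ := by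
    filter_upwards [hlaw.1] with μ hc n
    obtain ⟨S, -, hsep, rfl⟩ := hc
    exact PalmUnimodularRigidity.count_restrict_floorNorm_preimage_lt_top hδ hsep n
  have hev := PalmUnimodularRigidity.ae_forall_map_sub_of_ae hlaw.2.1 hlf hall
  filter_upwards [hev] with μ hμ y hy η hη
  obtain ⟨n, hn⟩ := exists_nat_one_div_lt hη
  have h1 := (layeredAt_atoms_map_sub_iff 2 (19 / 10) (1 / ((n : ℝ) + 1)) μ y).1 (hμ y hy n)
  exact h1.mono le_rfl le_rfl hn.le

/-- **S2 composed**: exactification at every point + the exact local-to-global lemma. -/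
theorem exactLayeredGlobal_of
    (hex : ∀ δ : ℝ, 0 < δ → ∀ S : Set E3, (∀ x ∈ S, ∀ y ∈ S, x ≠ y → δ ≤ dist x y) →
      ∀ y ∈ S, (∀ η : ℝ, 0 < η → LayeredAt 2 (19 / 10) η S y) → ExactLayeredAt S y)
    (hglob : ∀ δ : ℝ, 0 < δ → ∀ S : Set E3, (0 : E3) ∈ S → (∀ x ∈ S, ∀ y ∈ S, x ≠ y → δ ≤ dist x y) →
      (∀ y ∈ S, ExactLayeredAt S y) → GlobalLayered S)
    {δ : ℝ} (hδ : 0 < δ) (S : Set E3) (h0 : (0 : E3) ∈ S)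
    (hsep : ∀ x ∈ S, ∀ y ∈ S, x ≠ y → δ ≤ dist x y)
    (hlay : ∀ y ∈ S, ∀ η : ℝ, 0 < η → LayeredAt 2 (19 / 10) η S y) : GlobalLayered S :=
  hglob δ hδ S h0 hsep fun y hy => hex δ hδ S hsep y hy (hlay y hy)

/-- **Item 9224 from the stubs**: floors ⇒ a.s. everywhere `∀η`-layered ⇒ globally exactly layered ⇒
mean Hägg selection proves `PalmRigidity` (route `PalmUnimodularRigidity`'s target) itself.  Sorry-free;
the hypotheses are the seven stub statements. -/
theorem PalmRigidity_of_stubs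
    (h0 : CoerciveTwoShellGap ∧ NearFieldConvexity)
    (hsel : ∀ δ : ℝ, 0 < δ → ∀ P : Measure (Measure E3), IsProbabilityMeasure P → IsMinimisingLaw δ P →
      ∀ G : Set (Measure E3), MeasurableSet G → P Gᶜ ≠ 0 → ClusterSelectionFor δ G)
    (hsand : ∀ δ η : ℝ, 0 < δ → 0 < η → ∃ G : Set (Measure E3), MeasurableSet G ∧
      (∀ μ : Measure E3, IsRootedHardCore δ μ → μ ∈ G → LayeredAt 2 (19 / 10) η (atoms μ) 0) ∧
      (∀ μ : Measure E3, IsRootedHardCore δ μ → LayeredAt 2 2 (η / 2) (atoms μ) 0 → μ ∈ G))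
    (happ : CoerciveTwoShellGap → NearFieldConvexity → ∀ δ : ℝ, 0 < δ → ∀ P : Measure (Measure E3),
      IsProbabilityMeasure P → IsMinimisingLaw δ P →
      (∀ G : Set (Measure E3), MeasurableSet G → P Gᶜ ≠ 0 → ClusterSelectionFor δ G) →
      ∀ η : ℝ, 0 < η → ∀ G : Set (Measure E3), MeasurableSet G →
      (∀ μ : Measure E3, IsRootedHardCore δ μ → LayeredAt 2 2 η (atoms μ) 0 → μ ∈ G) → P Gᶜ = 0)
    (hex : ∀ δ : ℝ, 0 < δ → ∀ S : Set E3, (∀ x ∈ S, ∀ y ∈ S, x ≠ y → δ ≤ dist x y) →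
      ∀ y ∈ S, (∀ η : ℝ, 0 < η → LayeredAt 2 (19 / 10) η S y) → ExactLayeredAt S y)
    (hglob : ∀ δ : ℝ, 0 < δ → ∀ S : Set E3, (0 : E3) ∈ S → (∀ x ∈ S, ∀ y ∈ S, x ≠ y → δ ≤ dist x y) →
      (∀ y ∈ S, ExactLayeredAt S y) → GlobalLayered S)
    (h3 : ∀ δ : ℝ, 0 < δ → ∀ P : Measure (Measure E3), IsProbabilityMeasure P → IsMinimisingLaw δ P →
      (∀ᵐ μ ∂P, GlobalLayered (atoms μ)) → ∀ᵐ μ ∂P, IsOptimalHcpSample μ) :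
    PalmRigidity := by
  intro δ hδ P hP hcore hstat hE
  have hlaw : IsMinimisingLaw δ P := ⟨hcore, hstat, hE⟩
  have hlay := floorsToLaw_of hsel hsand happ h0.1 h0.2 hδ P hlaw
  have hglobal : ∀ᵐ μ ∂P, GlobalLayered (atoms μ) := by
    filter_upwards [hlay, hlaw.1] with μ hμ hc
    obtain ⟨S, h0S, hsep, rfl⟩ := hc
    rw [atoms_count_restrict] at hμ ⊢
    exact exactLayeredGlobal_of hex hglob hδ S h0S hsep hμ
  exact h3 δ hδ P hP hlaw hglobal

/-- **THE COMPOSITION** — the crux BY NAME from the seven stub statements (sorry-free): through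
`PalmRigidity_of_stubs` and the landed closure
`EkelandSurgeryParityClosure.slackRigidity_of_palmRigidity : PalmRigidity → SlackRigidity` (p122051). -/
theorem SlackRigidity_of_stubs
    (h0 : CoerciveTwoShellGap ∧ NearFieldConvexity)
    (hsel : ∀ δ : ℝ, 0 < δ → ∀ P : Measure (Measure E3), IsProbabilityMeasure P → IsMinimisingLaw δ P →
      ∀ G : Set (Measure E3), MeasurableSet G → P Gᶜ ≠ 0 → ClusterSelectionFor δ G)
    (hsand : ∀ δ η : ℝ, 0 < δ → 0 < η → ∃ G : Set (Measure E3), MeasurableSet G ∧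
      (∀ μ : Measure E3, IsRootedHardCore δ μ → μ ∈ G → LayeredAt 2 (19 / 10) η (atoms μ) 0) ∧
      (∀ μ : Measure E3, IsRootedHardCore δ μ → LayeredAt 2 2 (η / 2) (atoms μ) 0 → μ ∈ G))
    (happ : CoerciveTwoShellGap → NearFieldConvexity → ∀ δ : ℝ, 0 < δ → ∀ P : Measure (Measure E3),
      IsProbabilityMeasure P → IsMinimisingLaw δ P →
      (∀ G : Set (Measure E3), MeasurableSet G → P Gᶜ ≠ 0 → ClusterSelectionFor δ G) →
      ∀ η : ℝ, 0 < η → ∀ G : Set (Measure E3), MeasurableSet G →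
      (∀ μ : Measure E3, IsRootedHardCore δ μ → LayeredAt 2 2 η (atoms μ) 0 → μ ∈ G) → P Gᶜ = 0)
    (hex : ∀ δ : ℝ, 0 < δ → ∀ S : Set E3, (∀ x ∈ S, ∀ y ∈ S, x ≠ y → δ ≤ dist x y) →
      ∀ y ∈ S, (∀ η : ℝ, 0 < η → LayeredAt 2 (19 / 10) η S y) → ExactLayeredAt S y)
    (hglob : ∀ δ : ℝ, 0 < δ → ∀ S : Set E3, (0 : E3) ∈ S → (∀ x ∈ S, ∀ y ∈ S, x ≠ y → δ ≤ dist x y) →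
      (∀ y ∈ S, ExactLayeredAt S y) → GlobalLayered S)
    (h3 : ∀ δ : ℝ, 0 < δ → ∀ P : Measure (Measure E3), IsProbabilityMeasure P → IsMinimisingLaw δ P →
      (∀ᵐ μ ∂P, GlobalLayered (atoms μ)) → ∀ᵐ μ ∂P, IsOptimalHcpSample μ) :
    SlackRigidity :=
  EkelandSurgeryParityClosure.slackRigidity_of_palmRigidity
    (PalmRigidity_of_stubs h0 hsel hsand happ hex hglob h3)

/-- **The crux from the registered stubs** (modulo the seven `sorry`s above, nothing else). -/
theorem SlackRigidity_of : SlackRigidity :=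
  SlackRigidity_of_stubs stub_pricedInequalities stub_clusterSelection stub_layeredSandwich
    stub_floorsApplication stub_exactify stub_globalize stub_layeredMeanSelection

/-! ## Alternative residuals (lead c21, LANDED p156040): the crux from ONE weaker one-scale statement -/

/- **`FiniteLayerRigidity ⇒ SlackRigidity`** (tree theorem
`SlackRigidityPricedFloorsLayerFloor.lms_slackRigidity_of_finiteLayerRigidity`): the WEAKEST residual of
the line — near-minimal δ-separated finite clusters have at most a `b`-fraction of particles not
`η`-layered at radius `2`.  Sorry-free; closing one-liner if a planner ever files this statement.
(An `example`, not a theorem: its hypothesis is deliberately NOT a declared stub of the skeleton.) -/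
example : (∀ δ : ℝ, 0 < δ → ∀ η : ℝ, 0 < η → ∀ b : ℝ, 0 < b → ∃ τ : ℝ, 0 < τ ∧ ∃ M : ℕ, ∀ (N : ℕ) (x : Fin N → E3), M ≤ N → (∀ i j : Fin N, i ≠ j → δ ≤ dist (x i) (x j)) → interactionEnergy lennardJones x ≤ (N : ℝ) * eStar + τ * N → (Nat.card {i : Fin N // ¬ LayeredAt 2 2 η (Set.range x) (x i)} : ℝ) ≤ b * N) → SlackRigidity :=
  SlackRigidityPricedFloorsLayerFloor.lms_slackRigidity_of_finiteLayerRigidity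

/- **`LayerFloor ⇒ SlackRigidity`** (tree theorem `…LayerFloor.lms_slackRigidity_of_layerFloor`): the
selector-free priced floor S⁺₆ of `STRATEGY-CENSUS.md` closes the crux.  Sorry-free (`example`). -/
example : (∀ δ : ℝ, 0 < δ → ∀ η : ℝ, 0 < η → ∃ κ : ℝ, 0 < κ ∧ ∀ (N : ℕ) (x : Fin N → E3), (∀ i j : Fin N, i ≠ j → δ ≤ dist (x i) (x j)) → (N : ℝ) * eStar + κ * (Nat.card {i : Fin N // ¬ LayeredAt 2 2 η (Set.range x) (x i)} : ℝ) ≤ interactionEnergy lennardJones x) → SlackRigidity :=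
  SlackRigidityPricedFloorsLayerFloor.lms_slackRigidity_of_layerFloor

/-- **The pair factors through both** (tree theorems `lms_layerFloor_of_pricedInequalities`,
`lms_finiteLayerRigidity_of_layerFloor`): 13956 ∧ 13958 ⇒ LayerFloor ⇒ FiniteLayerRigidity.  Sorry-free. -/
theorem finiteLayerRigidity_of_pricedInequalities (h : CoerciveTwoShellGap ∧ NearFieldConvexity) : ∀ δ : ℝ, 0 < δ → ∀ η : ℝ, 0 < η → ∀ b : ℝ, 0 < b → ∃ τ : ℝ, 0 < τ ∧ ∃ M : ℕ, ∀ (N : ℕ) (x : Fin N → E3), M ≤ N → (∀ i j : Fin N, i ≠ j → δ ≤ dist (x i) (x j)) → interactionEnergy lennardJones x ≤ (N : ℝ) * eStar + τ * N → (Nat.card {i : Fin N // ¬ LayeredAt 2 2 η (Set.range x) (x i)} : ℝ) ≤ b * N :=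
  SlackRigidityPricedFloorsLayerFloor.lms_finiteLayerRigidity_of_layerFloor
    (SlackRigidityPricedFloorsLayerFloor.lms_layerFloor_of_pricedInequalities h.1 h.2)

/-- The crux from the registered stub along the c21 path (same `sorry`, shorter chain). -/
theorem SlackRigidity_of' : SlackRigidity :=
  SlackRigidityPricedFloorsLayerFloor.lms_slackRigidity_of_finiteLayerRigidity
    (finiteLayerRigidity_of_pricedInequalities stub_pricedInequalities)

/-! ## Faithfulness of the residual (lead c22, LANDED p158430 / p159046) -/

/- **`PalmRigidity ↔ FiniteLayerRigidity ∧ HcpOptimalInBox`** (tree theorem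
`SlackRigidityFlrOfPalm.lms_palmRigidity_iff_finiteLayerRigidity_and_hcpOptimal`): item 9224 is EXACTLY the
weakest residual of this line plus "an optimal relaxed hcp lies in the box".  Sorry-free (`example`). -/
example : PalmRigidity ↔ (∀ δ : ℝ, 0 < δ → ∀ η : ℝ, 0 < η → ∀ b : ℝ, 0 < b → ∃ τ : ℝ, 0 < τ ∧ ∃ M : ℕ, ∀ (N : ℕ) (x : Fin N → E3), M ≤ N → (∀ i j : Fin N, i ≠ j → δ ≤ dist (x i) (x j)) → interactionEnergy lennardJones x ≤ (N : ℝ) * eStar + τ * N → (Nat.card {i : Fin N // ¬ LayeredAt 2 2 η (Set.range x) (x i)} : ℝ) ≤ b * N) ∧ (∃ a h : ℝ, ∃ ha : a ≠ 0, ∃ hh : h ≠ 0, 1 / 2 ≤ a ∧ a ≤ 2 ∧ 1 / 2 ≤ h ∧ h ≤ 2 ∧ (hcpPeriodicConfiguration ha hh).energyPerParticle lennardJones = (⨅ Q : PeriodicConfiguration 3, Q.energyPerParticle lennardJones)) :=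
  SlackRigidityFlrOfPalm.lms_palmRigidity_iff_finiteLayerRigidity_and_hcpOptimal

/- **`HcpOptimalInBox → (FiniteLayerRigidity ↔ SlackRigidity)`** (tree theorem
`SlackRigidityFlrOfPalm.lms_finiteLayerRigidity_iff_slackRigidity_of_hcpOptimal`).  Sorry-free (`example`). -/
example : (∃ a h : ℝ, ∃ ha : a ≠ 0, ∃ hh : h ≠ 0, 1 / 2 ≤ a ∧ a ≤ 2 ∧ 1 / 2 ≤ h ∧ h ≤ 2 ∧ (hcpPeriodicConfiguration ha hh).energyPerParticle lennardJones = (⨅ Q : PeriodicConfiguration 3, Q.energyPerParticle lennardJones)) → ((∀ δ : ℝ, 0 < δ → ∀ η : ℝ, 0 < η → ∀ b : ℝ, 0 < b → ∃ τ : ℝ, 0 < τ ∧ ∃ M : ℕ, ∀ (N : ℕ) (x : Fin N → E3), M ≤ N → (∀ i j : Fin N, i ≠ j → δ ≤ dist (x i) (x j)) → interactionEnergy lennardJones x ≤ (N : ℝ) * eStar + τ * N → (Nat.card {i : Fin N // ¬ LayeredAt 2 2 η (Set.range x) (x i)} : ℝ) ≤ b * N) ↔ SlackRigidity) :=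
  SlackRigidityFlrOfPalm.lms_finiteLayerRigidity_iff_slackRigidity_of_hcpOptimal

/- **Certified admissibility of an optimal relaxed hcp** (tree theorem
`SlackRigidityHcpAdmissible.lms_hcpOptimal_admissible`): `h/a ∈ (0.8148, 0.8250)`, `a ∈ [0.963, 0.976]`,
hence `a ∈ [47/50, 1]`, `h ∈ [39a/50, 17a/20]` (item 13958's layered family).  Sorry-free (`example`). -/
example : ∀ (a h : ℝ) (ha : a ≠ 0) (hh : h ≠ 0), 1 / 2 ≤ a → a ≤ 2 → 1 / 2 ≤ h → h ≤ 2 → (hcpPeriodicConfiguration ha hh).energyPerParticle lennardJones = (⨅ Q : PeriodicConfiguration 3, Q.energyPerParticle lennardJones) → (8148 / 10000 < h / a ∧ h / a < 8250 / 10000 ∧ 963 / 1000 ≤ a ∧ a ≤ 976 / 1000) ∧ (47 / 50 ≤ a ∧ a ≤ 1 ∧ 39 / 50 * a ≤ h ∧ h ≤ 17 / 20 * a) :=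
  SlackRigidityHcpAdmissible.lms_hcpOptimal_admissible

/-! ## Readback (the names this line leans on elaborate) -/

example : PalmRigidity → SlackRigidity := EkelandSurgeryParityClosure.slackRigidity_of_palmRigidity
example : eStar = ⨅ Q : PeriodicConfiguration 3, Q.energyPerParticle lennardJones := rfl

end Summit.AtomisticToContinuum.Crystallization.Cruxes.SlackRigidity.PricedFloorsPalmExactification

end
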